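import Summits.QuantumFields.BalabanUV.Beta.SpineRecursiveT2StepSym
import Summits.QuantumFields.BalabanUV.Beta.SecondOrderSymContact

/-!
# `BalabanUV.Beta.SpineRecursiveWLawSym` — binder row D1, (N7c-i) of the second-order hR slot port: **THE W-LAW OF THE SLOTTED W-TABLE
# `WrecOf d Lc (Gsym Lc) Sp (M1Of H cΛ) … j` FROM THE SECOND-ORDER LETTERS AT LEVEL `j`** — (hT2-rem)(j) for `T2RecOf … j`, the mixed letter (hM2-rem) for
# `M2Of mixFF j`, the split identity (hsplit) and the localisation (hDg), at the (0.4) literal's symmetrised resolvents `Gsym Lc j` against the shifted spread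
# `bhKStepSh d Lc Dsh j` with the border-reading generator `ctGenM d (bhK Lc + Dsh) α Lc` — slot twin of `SpineRecursiveWSockets.WrecAt_bref_of_T2RM`
# (β sub-cell, BINDER-OWNERS row D1 OWNER `b2b-balaban-beta-an2`, gen 31; memo `gen30/N7-SCOPE.v1.md` §4 (N7c), RULING R-D1-g28-2)

HONEST FRAMING (cell charter, verbatim): «discharging BetaPertH makes Bałaban's UV stability UNCONDITIONAL — a real constructive-QFT result; it is
NOT the continuum limit and NOT the Clay problem.»  HONEST DEPENDENCY: continuum YM on T⁴ ⇐ BetaPertH ∧ nine spine estimates (0/9 proved); BetaPertH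
⇐ (D1) ∧ (D4) ∧ CAP+tail; G-an2-4 gates asym, D1 and NE2/3/4.  DERIVED cell leaf (wiring, [folklore]): `RecursiveWSlot.WrecOf_eq` +
`SecondOrderTransport.W2SymOfK_bref_sharp` (transport, `E`-free) + `SecondOrderSymContact.W2SymOfK_sharp_split_of` (the symmetrised assembled identity from
its two orientations); no statement of Bałaban's papers, no `[cite:]`, no `def`, no `Prop` fact; EVERY LETTER IS A HYPOTHESIS; instantiates no binder of the
wall.  NOT D1, NOT `BetaPertH`, NOT continuum, NOT Clay.

## What is here (`G_j := Gsym Lc j`, `𝕄_j := bhKStepSh d Lc Dsh j`, `Sp_j := SpureRecOf d Lc V H (Gsym Lc) cE cVH cΛ j`, `M_j := M1Of d Lc H cΛ j`,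
## `T2_j := T2RecOf d Lc (Gsym Lc) Sp M cE₂ cB T vh₂S mixFF j`, `W_j := WrecOf … j = W2SymOfK G_j Lc Sp_j M_j T2_j (M2Of mixFF j)`, `X_j κ u := diagK (γ_j·ctGenM d (bhK Lc + Dsh) α Lc κ u)`)

**`WrecOf_bref_of_T2RM_sym`** — HYPOTHESES (level `j`, axis `α`): `Odd Lc`; (hSp) the sharp law of `Sp_j` (contact `X_j` against `𝕄_j`); (H-r) of `H` (⇒ pure
sign for `M_j`, `ReflectionLocusSymPure.M1Of_bref`); (hT2) the law of `T2_j` with ♯-bi-table `conjW 𝕄_j (Sp_j κ u) (Sp_j κ′ u′) (X_j κ u) (X_j κ′ u′) (diagK h) + R2`;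
(hM2) the mixed letter with ♯-bi-table `conjV (M_j ρ w) (X_j κ u) + RM`; (hsplit) the split identity of `W2OfK G_j Lc S♯ M T2♯ M2♯` against
`W2OfK G_j Lc Sp_j M_j T2_j (M2Of j)` with the dressed generators, second symbol `X2s` and residual `Δ` (mechanical, (W-SPLIT-DECAY)); (hDg) localisation of
`dM G_j Lc S♯ M_j`.  CONCLUSION: the W-law of `W_j` with ♯-bi-table of SIMILARITY SHAPE —
`W_j μ (bref y) ν (bref y′) = (ε ε) • refK (W_j μ y ν y′ + conjW 𝕄_j (dM G_j Lc Sp_j M_j μ y) (dM … ν y′) (diagK Gᵞ_{μ,y}) (diagK Gᵞ_{ν,y′}) (diagK X2s) + Rm)`,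
`Rm := ½•conjV 𝕄_j (diagK (X2sᵀ − X2s)) + ½•(Δ + Δᵀ)` — EXACTLY the (hWlaw) input of `SpineRecursiveT2StepSym.T2RecOf_succ_bref_of_laws_sym`.
Provenance: β sub-cell, unit beta-an2 gen 31, 2026-08-21 (v1); statement and two-line proof = `SpineRecursiveWSockets.WrecAt_bref_of_T2RM` (an2 gen 18) with
`(coDressKBmAt, bhKStepAt, SpureRecAt, M1At, T2RecAt, WrecAt, ctGen) ↦ (Gsym, bhKStepSh Dsh, SpureRecOf, M1Of, T2RecOf, WrecOf, ctGenM (bhK + Dsh))`;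
no existing file touched.
-/

open Finset
open scoped BigOperators
open Literature.MathematicalPhysics.QuantumFieldTheory
open Literature.MathematicalPhysics.QuantumFieldTheory.Balaban1983to89
open Literature.MathematicalPhysics.QuantumFieldTheory.Balaban1983to89.Beta
open ExpKernelCalculus (MKer Decays BiLoc comp VertexFamily)
open PolarizationSign (reflSign)
open KernelReflection (refK)
open ResolventReflection (bref Φ)
open OneStepResolventKernel (Fib LocStencil)
open OneStepKernelFamily (KInvStep colH)
open BalabanStepJetsSucc (wVH)
open BalabanStepW2 (M2Of)
open SecondOrderResponse (dM W2OfK W2SymOfK)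
open Summit.QuantumFields.BalabanUV.Beta.TameKernelCalculus
open Summit.QuantumFields.BalabanUV.Beta.ChartConjugation (conjV conjW)
open Summit.QuantumFields.BalabanUV.Beta.BorderedHessian (bhK diagK stepScale)
open Summit.QuantumFields.BalabanUV.Beta.SymmetrisedStepJets (Gsym Gsym_apply)
open Summit.QuantumFields.BalabanUV.Beta.SymShiftedSpread (bhKStepSh)
open Summit.QuantumFields.BalabanUV.Beta.E3ContactGenerator (ctGenM)
open Summit.QuantumFields.BalabanUV.Beta.SymmetrisedDressingReflection (refK_coDressKSymAt_KInvStep)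
open Summit.QuantumFields.BalabanUV.Beta.RelInvFactorSandwich (spr_Gsym)
open Summit.QuantumFields.BalabanUV.Beta.ReflectionLocusSymPure (M1Of_bref)
open Summit.QuantumFields.BalabanUV.Beta.SecondOrderTransport (W2SymOfK_bref_sharp)
open Summit.QuantumFields.BalabanUV.Beta.SecondOrderSymContact (W2SymOfK_sharp_split_of)

noncomputable section

namespace Summit.QuantumFields.BalabanUV.Beta.SpineRooted

section WLawSym

variable {d Lc : ℕ} [NeZero Lc]

/-- [folklore] **THE W-LAW OF THE SLOTTED W-TABLE AT THE SYMMETRISED RESOLVENTS FROM (hT2-rem), (hM2-rem), (hsplit), (hDg)** (see the module docstring). -/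
theorem WrecOf_bref_of_T2RM_sym (hLc : Odd Lc) {Dsh : MKer (d + 1) (Fib d)}
    {V H : Fin (d + 1) → (Fin (d + 1) → ℤ) → MKer (d + 1) (Fib d)}
    (hHr : ∀ (α μ : Fin (d + 1)) (y : Fin (d + 1) → ℤ), H μ (bref α μ y) = reflSign α μ • refK (Φ (d := d) Lc α) (H μ y))
    (cE cVH cΛ cE₂ cB : ℝ) (T : Fin 4 → Fin 4 → Fin 4 → Fin 4 → ℝ)
    (vh₂S mixFF : Fin (d + 1) → (Fin (d + 1) → ℤ) → Fin (d + 1) → (Fin (d + 1) → ℤ) → MKer (d + 1) (Fib d))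
    (γ : ℕ → ℝ) (j : ℕ) (α : Fin (d + 1))
    (hSp : ∀ κ u, SpureRecOf d Lc V H (Gsym Lc) cE cVH cΛ j κ (bref α κ u) = reflSign α κ • refK (Φ Lc α)
      (SpureRecOf d Lc V H (Gsym Lc) cE cVH cΛ j κ u + conjV (bhKStepSh d Lc Dsh j) (diagK fun p c => γ j * ctGenM d (bhK Lc + Dsh) α Lc κ u p c)))
    (h : Fin (d + 1) → (Fin (d + 1) → ℤ) → Fin (d + 1) → (Fin (d + 1) → ℤ) → (Fin (d + 1) → ℤ) → Fib d → ℝ)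
    (R2 : Fin (d + 1) → (Fin (d + 1) → ℤ) → Fin (d + 1) → (Fin (d + 1) → ℤ) → MKer (d + 1) (Fib d))
    (RM : Fin (d + 1) → (Fin (d + 1) → ℤ) → Fin (d + 1) → (Fin (d + 1) → ℤ) → MKer (d + 1) (Fib d))
    (hT2 : ∀ (κ : Fin (d + 1)) (u : Fin (d + 1) → ℤ) (κ' : Fin (d + 1)) (u' : Fin (d + 1) → ℤ),
      T2RecOf d Lc (Gsym Lc) (SpureRecOf d Lc V H (Gsym Lc) cE cVH cΛ) (M1Of d Lc H cΛ) cE₂ cB T vh₂S mixFF j κ (bref α κ u) κ' (bref α κ' u') =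
        (reflSign α κ * reflSign α κ') • refK (Φ Lc α)
          (T2RecOf d Lc (Gsym Lc) (SpureRecOf d Lc V H (Gsym Lc) cE cVH cΛ) (M1Of d Lc H cΛ) cE₂ cB T vh₂S mixFF j κ u κ' u' +
            conjW (bhKStepSh d Lc Dsh j)
              (SpureRecOf d Lc V H (Gsym Lc) cE cVH cΛ j κ u) (SpureRecOf d Lc V H (Gsym Lc) cE cVH cΛ j κ' u')
              (diagK fun p c => γ j * ctGenM d (bhK Lc + Dsh) α Lc κ u p c) (diagK fun p c => γ j * ctGenM d (bhK Lc + Dsh) α Lc κ' u' p c)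
              (diagK (h κ u κ' u')) +
            R2 κ u κ' u'))
    (hM2 : ∀ (κ : Fin (d + 1)) (u : Fin (d + 1) → ℤ) (ρ : Fin (d + 1)) (w : Fin (d + 1) → ℤ),
      M2Of d Lc mixFF j κ (bref α κ u) ρ (bref α ρ w) =
        (reflSign α κ * reflSign α ρ) • refK (Φ Lc α)
          (M2Of d Lc mixFF j κ u ρ w + conjV (M1Of d Lc H cΛ j ρ w) (diagK fun p c => γ j * ctGenM d (bhK Lc + Dsh) α Lc κ u p c) + RM κ u ρ w))
    (X2s : Fin (d + 1) → (Fin (d + 1) → ℤ) → Fin (d + 1) → (Fin (d + 1) → ℤ) → (Fin (d + 1) → ℤ) → Fib d → ℝ)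
    (Δ : Fin (d + 1) → (Fin (d + 1) → ℤ) → Fin (d + 1) → (Fin (d + 1) → ℤ) → MKer (d + 1) (Fib d))
    (hsplit : ∀ (μ : Fin (d + 1)) (y : Fin (d + 1) → ℤ) (ν : Fin (d + 1)) (y' : Fin (d + 1) → ℤ),
      W2OfK (Gsym (d := d) Lc j) Lc
          (fun κ u => SpureRecOf d Lc V H (Gsym Lc) cE cVH cΛ j κ u +
            conjV (bhKStepSh d Lc Dsh j) (diagK fun p c => γ j * ctGenM d (bhK Lc + Dsh) α Lc κ u p c))
          (M1Of d Lc H cΛ j)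
          (fun κ u κ' u' => T2RecOf d Lc (Gsym Lc) (SpureRecOf d Lc V H (Gsym Lc) cE cVH cΛ) (M1Of d Lc H cΛ) cE₂ cB T vh₂S mixFF j κ u κ' u' +
            conjW (bhKStepSh d Lc Dsh j)
              (SpureRecOf d Lc V H (Gsym Lc) cE cVH cΛ j κ u) (SpureRecOf d Lc V H (Gsym Lc) cE cVH cΛ j κ' u')
              (diagK fun p c => γ j * ctGenM d (bhK Lc + Dsh) α Lc κ u p c) (diagK fun p c => γ j * ctGenM d (bhK Lc + Dsh) α Lc κ' u' p c)
              (diagK (h κ u κ' u')) +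
            R2 κ u κ' u')
          (fun κ u ρ w => M2Of d Lc mixFF j κ u ρ w + conjV (M1Of d Lc H cΛ j ρ w) (diagK fun p c => γ j * ctGenM d (bhK Lc + Dsh) α Lc κ u p c) +
            RM κ u ρ w)
          μ y ν y' =
        W2OfK (Gsym (d := d) Lc j) Lc (SpureRecOf d Lc V H (Gsym Lc) cE cVH cΛ j) (M1Of d Lc H cΛ j)
            (T2RecOf d Lc (Gsym Lc) (SpureRecOf d Lc V H (Gsym Lc) cE cVH cΛ) (M1Of d Lc H cΛ) cE₂ cB T vh₂S mixFF j) (M2Of d Lc mixFF j) μ y ν y' +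
          conjW (bhKStepSh d Lc Dsh j)
            (dM (Gsym Lc j) Lc (SpureRecOf d Lc V H (Gsym Lc) cE cVH cΛ j) (M1Of d Lc H cΛ j) μ y)
            (dM (Gsym Lc j) Lc (SpureRecOf d Lc V H (Gsym Lc) cE cVH cΛ j) (M1Of d Lc H cΛ j) ν y')
            (diagK fun p c => ∑ κ, ∑' u, colH (Gsym Lc j) Lc μ y κ u * (γ j * ctGenM d (bhK Lc + Dsh) α Lc κ u p c))
            (diagK fun p c => ∑ κ, ∑' u, colH (Gsym Lc j) Lc ν y' κ u * (γ j * ctGenM d (bhK Lc + Dsh) α Lc κ u p c))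
            (diagK (X2s μ y ν y')) +
          Δ μ y ν y')
    (hDg : ∀ (ν : Fin (d + 1)) (y' : Fin (d + 1) → ℤ),
      Loc (dM (Gsym (d := d) Lc j) Lc
        (fun κ u => SpureRecOf d Lc V H (Gsym Lc) cE cVH cΛ j κ u +
          conjV (bhKStepSh d Lc Dsh j) (diagK fun p c => γ j * ctGenM d (bhK Lc + Dsh) α Lc κ u p c))
        (M1Of d Lc H cΛ j) ν y'))
    (μ : Fin (d + 1)) (y : Fin (d + 1) → ℤ) (ν : Fin (d + 1)) (y' : Fin (d + 1) → ℤ) :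
    WrecOf d Lc (Gsym Lc) (SpureRecOf d Lc V H (Gsym Lc) cE cVH cΛ) (M1Of d Lc H cΛ) cE₂ cB T vh₂S mixFF j μ (bref α μ y) ν (bref α ν y') =
      (reflSign α μ * reflSign α ν) • refK (Φ Lc α)
        (WrecOf d Lc (Gsym Lc) (SpureRecOf d Lc V H (Gsym Lc) cE cVH cΛ) (M1Of d Lc H cΛ) cE₂ cB T vh₂S mixFF j μ y ν y' +
          conjW (bhKStepSh d Lc Dsh j)
            (dM (Gsym Lc j) Lc (SpureRecOf d Lc V H (Gsym Lc) cE cVH cΛ j) (M1Of d Lc H cΛ j) μ y)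
            (dM (Gsym Lc j) Lc (SpureRecOf d Lc V H (Gsym Lc) cE cVH cΛ j) (M1Of d Lc H cΛ j) ν y')
            (diagK fun p c => ∑ κ, ∑' u, colH (Gsym Lc j) Lc μ y κ u * (γ j * ctGenM d (bhK Lc + Dsh) α Lc κ u p c))
            (diagK fun p c => ∑ κ, ∑' u, colH (Gsym Lc j) Lc ν y' κ u * (γ j * ctGenM d (bhK Lc + Dsh) α Lc κ u p c))
            (diagK (X2s μ y ν y')) +
          ((1 / 2 : ℝ) • conjV (bhKStepSh d Lc Dsh j) (diagK fun p a => X2s ν y' μ y p a - X2s μ y ν y' p a) +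
            (1 / 2 : ℝ) • (Δ μ y ν y' + Δ ν y' μ y))) := by
  have hKr : refK (Φ (d := d) Lc α) (Gsym (d := d) Lc j) = Gsym Lc j := by rw [Gsym_apply]; exact refK_coDressKSymAt_KInvStep hLc j α
  have hMr : ∀ (ρ : Fin (d + 1)) (w : Fin (d + 1) → ℤ),
      M1Of d Lc H cΛ j ρ (bref α ρ w) = reflSign α ρ • refK (Φ Lc α) (M1Of d Lc H cΛ j ρ w) := fun ρ w => M1Of_bref hHr cΛ j α ρ w
  rw [WrecOf_eq, W2SymOfK_bref_sharp hKr (spr_Gsym j) hSp hMr hT2 hM2 hDg μ y ν y', W2SymOfK_sharp_split_of (hsplit μ y ν y') (hsplit ν y' μ y)]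

end WLawSym

end Summit.QuantumFields.BalabanUV.Beta.SpineRooted

end
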